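import Mathlib
import Literature.NumberTheory.Irrationality.BrownZudilin2022.CubicalForm
import Literature.NumberTheory.Transcendental.KZSliceFubini
import Summits.KontsevichZagierPeriods.Zeta5Search.CubicalSubstitution
import Summits.KontsevichZagierPeriods.Zeta5Search.BarnesSymmetry
import Summits.KontsevichZagierPeriods.Zeta5Search.EulerKernelSymmetry
import HarnessLib

/-!
# ζ(5) search — the symmetry `p₀₁` of `J(p;q)` and of (27) BEYOND the chamber of (16) (cell `pub-zeta5`, seat ct-1 g12)

HONEST FRAMING: systematic search; no irrationality claim unless kernel-certified. Nothing in this file is an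
irrationality result, a worthiness exponent or a denominator statement; these are identities between Brown–Zudilin's
real integrals `J(p;q)` (10) and `I(a)` (1). `BarnesSymmetry.lean` (ct-1 g11) proved the 'trivial' hypergeometric
symmetries `p₀₁`, `p₁₂` [BrownZudilin2022, Sect. 7, first half] from the Barnes representation (16), hence only for
non-negative letters AND a non-empty chamber; on the 8-parameter family the letter `p₀(a) = h₁₉(a)` is not a convergence
form, so the chamber hypothesis is a genuine restriction there (in `[0,3]⁸`, 1,372 of 13,037 convergent pairs
`(a, p₀₁a)` have no chamber point). Here `p₀₁` is proved WITHOUT (16), by real-variable means only: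

* `setIntegral_openCube_eq_of_slices` — Tonelli along the first coordinate of `(0,1)⁵` (`KZ.measurePreserving_vecCons`),
  for measurable functions non-negative on the cube, in a form that needs NO integrability on the cube (both sides of
  the final identities are junk `0` together);
* `integrandJ_vecCons` — the `y₁`-dependence of the integrand (10) is `y₁^{p₁}(1−y₁)^{q₁}/((1−y₃) + y₃y₂·y₁)^{p₀+1}`;
* `Jintegral_p01` — `J(p₀₁(p;q))·p₁!q₁! = J(p;q)·p₀!(p₁+q₁−p₀)!` for ALL `(p;q)` with `p₀, p₁, q₁, p₁+q₁−p₀ ≥ 0`, from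
  `EulerKernelSymmetry.euler_symmetry` (the `₂F₁` parameter symmetry on Euler's integral, `α = 1−y₃`, `β = y₃y₂`)
  slice by slice — "the symmetry of the parameters `p₀+1` and `p₁+1`" of Sect. 7 read on (10) instead of (15)/(16);
* `cellularIntegral_genP01`, `normalisedIntegral'_genP01` — on the 8-parameter family: the `p₀₁`-conjunct of the named
  fact `invariance_of_converges'` ((27)) EXACTLY as typed, i.e. for every `a` with `a` and `p₀₁ a` convergent (the four
  sign conditions are convergence forms of `a` or of `p₀₁ a`).

The companion file `JintegralEulerP12.lean` does the same for `p₁₂` (fibration over `P = y₁y₂`) and assembles (27) for the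
whole 'trivial' group `⟨i₁, p₀₁, p₁₂⟩`; the generators `h, h'` (Bailey's `₇F₆` transformation) remain the one analytic
input of `invariance_of_converges'` not in the tree. Theorems only (no new definitions).
-/

noncomputable section

namespace Summit.KontsevichZagierPeriods.Zeta5Search.JintegralEulerSymmetry

open MeasureTheory Set Filter
open scoped ENNReal Nat
open Literature.NumberTheory.Irrationality.BrownZudilin2022
open Literature.NumberTheory.Transcendental (KZ.measurePreserving_vecCons KZ.measurableEmbedding_vecCons)
open Summit.KontsevichZagierPeriods.Zeta5Search.CubicalSubstitution (measurableSet_openCube)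
open Summit.KontsevichZagierPeriods.Zeta5Search.CellularCubicalSubstitution (cellularIntegral_eq_Jintegral)
open Summit.KontsevichZagierPeriods.Zeta5Search.BarnesSymmetry (pOf_genP01 qOf_genP01 normF_genP01 normF_pos)
open Summit.KontsevichZagierPeriods.Zeta5Search.EulerKernelSymmetry (euler_symmetry)

/-! ### Slicing the open cube along the first coordinate -/

/-- `vecCons s x ∈ (0,1)⁵` iff `s ∈ (0,1)` and `x ∈ (0,1)⁴`. -/
theorem vecCons_mem_openCube_iff (s : ℝ) (x : Fin 4 → ℝ) :
    Matrix.vecCons s x ∈ openCube ↔ s ∈ Ioo (0:ℝ) 1 ∧ x ∈ (univ.pi fun _ : Fin 4 => Ioo (0:ℝ) 1) := by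
  simp only [openCube, mem_setOf_eq, Fin.forall_fin_succ, Matrix.cons_val_zero, Matrix.cons_val_succ, mem_Ioo,
    mem_univ_pi]

/-- The preimage of the open cube under `(s, x) ↦ vecCons s x` is `(0,1) × (0,1)⁴`. -/
theorem vecCons_preimage_openCube :
    (fun p : ℝ × (Fin 4 → ℝ) => Matrix.vecCons p.1 p.2) ⁻¹' openCube =
      Ioo (0:ℝ) 1 ×ˢ (univ.pi fun _ : Fin 4 => Ioo (0:ℝ) 1) := by
  ext ⟨s, x⟩
  rw [mem_preimage, mem_prod]
  exact vecCons_mem_openCube_iff s x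

/-- **Tonelli along the first coordinate of the cube**: for measurable `F ≥ 0`,
`∫⁻_{(0,1)⁵} F = ∫⁻_{x ∈ (0,1)⁴} ∫⁻_{s ∈ (0,1)} F(s, x)`. -/
theorem lintegral_openCube_slice (F : (Fin 5 → ℝ) → ℝ≥0∞) (hF : Measurable F) :
    ∫⁻ y in openCube, F y =
      ∫⁻ x in (univ.pi fun _ : Fin 4 => Ioo (0:ℝ) 1), ∫⁻ s in Ioo (0:ℝ) 1, F (Matrix.vecCons s x) := by
  rw [← (KZ.measurePreserving_vecCons (n := 4)).setLIntegral_comp_preimage_emb KZ.measurableEmbedding_vecCons F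
      openCube, vecCons_preimage_openCube, ← Measure.prod_restrict, lintegral_prod_symm]
  exact (hF.comp (KZ.measurableEmbedding_vecCons (n := 4)).measurable).aemeasurable

/-- For measurable `H`, non-negative on the cube, with integrable slices: the cube integral is the (extended)
integral of the slice integrals. No integrability of `H` on the cube is needed (junk values agree). -/
theorem setIntegral_openCube_eq_lintegral_slices {H : (Fin 5 → ℝ) → ℝ} (hHm : Measurable H)
    (hH0 : ∀ y ∈ openCube, 0 ≤ H y)
    (hHi : ∀ x ∈ (univ.pi fun _ : Fin 4 => Ioo (0:ℝ) 1), IntegrableOn (fun s => H (Matrix.vecCons s x)) (Ioo 0 1)) :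
    ∫ y in openCube, H y =
      (∫⁻ x in (univ.pi fun _ : Fin 4 => Ioo (0:ℝ) 1),
        ENNReal.ofReal (∫ s in Ioo (0:ℝ) 1, H (Matrix.vecCons s x))).toReal := by
  rw [integral_eq_lintegral_of_nonneg_ae (ae_restrict_of_forall_mem measurableSet_openCube hH0)
      hHm.aestronglyMeasurable,
    lintegral_openCube_slice (fun y => ENNReal.ofReal (H y)) (ENNReal.measurable_ofReal.comp hHm)]
  congr 1
  refine setLIntegral_congr_fun (MeasurableSet.univ_pi fun _ => measurableSet_Ioo) (fun x hx => ?_)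
  rw [ofReal_integral_eq_lintegral_ofReal (hHi x hx)]
  exact ae_restrict_of_forall_mem measurableSet_Ioo fun s hs =>
    hH0 _ ((vecCons_mem_openCube_iff s x).mpr ⟨hs, hx⟩)

/-- **Master slice lemma.** If two measurable functions, non-negative on the open cube, have integrable slices
along the first coordinate whose integrals are proportional (`c·∫F(s,x)ds = d·∫G(s,x)ds` for every
`x ∈ (0,1)⁴`, `c, d ≥ 0`), then `c·∫_{(0,1)⁵} F = d·∫_{(0,1)⁵} G` — with no integrability hypothesis on the cube. -/
theorem setIntegral_openCube_eq_of_slices {F G : (Fin 5 → ℝ) → ℝ} (hFm : Measurable F) (hGm : Measurable G)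
    (hF0 : ∀ y ∈ openCube, 0 ≤ F y) (hG0 : ∀ y ∈ openCube, 0 ≤ G y) {c d : ℝ} (hc : 0 ≤ c) (hd : 0 ≤ d)
    (h : ∀ x ∈ (univ.pi fun _ : Fin 4 => Ioo (0:ℝ) 1),
      IntegrableOn (fun s => F (Matrix.vecCons s x)) (Ioo 0 1) ∧
        IntegrableOn (fun s => G (Matrix.vecCons s x)) (Ioo 0 1) ∧
        c * ∫ s in Ioo (0:ℝ) 1, F (Matrix.vecCons s x) = d * ∫ s in Ioo (0:ℝ) 1, G (Matrix.vecCons s x)) :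
    c * ∫ y in openCube, F y = d * ∫ y in openCube, G y := by
  rw [setIntegral_openCube_eq_lintegral_slices hFm hF0 (fun x hx => (h x hx).1),
    setIntegral_openCube_eq_lintegral_slices hGm hG0 (fun x hx => (h x hx).2.1),
    ← ENNReal.toReal_ofReal hc, ← ENNReal.toReal_ofReal hd, ← ENNReal.toReal_mul, ← ENNReal.toReal_mul,
    ← lintegral_const_mul' _ _ ENNReal.ofReal_ne_top, ← lintegral_const_mul' _ _ ENNReal.ofReal_ne_top]
  congr 1
  refine setLIntegral_congr_fun (MeasurableSet.univ_pi fun _ => measurableSet_Ioo) (fun x hx => ?_)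
  rw [← ENNReal.ofReal_mul hc, ← ENNReal.ofReal_mul hd, (h x hx).2.2]

/-! ### The integrand (10) sliced along `y₁` -/

/-- `integrandJ` is measurable. -/
theorem measurable_integrandJ (p : Fin 7 → ℤ) (q : Fin 5 → ℤ) : Measurable (integrandJ p q) := by
  unfold integrandJ
  fun_prop

/-- `integrandJ` is non-negative on the open cube (every base is positive there). -/
theorem integrandJ_nonneg (p : Fin 7 → ℤ) (q : Fin 5 → ℤ) {y : Fin 5 → ℝ} (hy : y ∈ openCube) :
    0 ≤ integrandJ p q y := by
  have h0 := hy 0; have h1 := hy 1; have h2 := hy 2; have h3 := hy 3; have h4 := hy 4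
  have a0 : 0 < 1 - y 0 := by linarith [h0.2]
  have a1 : 0 < 1 - y 1 := by linarith [h1.2]
  have a2 : 0 < 1 - y 2 := by linarith [h2.2]
  have a3 : 0 < 1 - y 3 := by linarith [h3.2]
  have a4 : 0 < 1 - y 4 := by linarith [h4.2]
  have b01 : 0 < 1 - y 2 * (1 - y 0 * y 1) := by
    have : y 2 * (1 - y 0 * y 1) < 1 := by
      calc y 2 * (1 - y 0 * y 1) ≤ y 2 * 1 := by
            apply mul_le_mul_of_nonneg_left _ h2.1.le; nlinarith [mul_pos h0.1 h1.1]
        _ < 1 := by linarith [h2.2]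
    linarith
  have b34 : 0 < 1 - y 2 * (1 - y 3 * y 4) := by
    have : y 2 * (1 - y 3 * y 4) < 1 := by
      calc y 2 * (1 - y 3 * y 4) ≤ y 2 * 1 := by
            apply mul_le_mul_of_nonneg_left _ h2.1.le; nlinarith [mul_pos h3.1 h4.1]
        _ < 1 := by linarith [h2.2]
    linarith
  have c0 := h0.1; have c1 := h1.1; have c2 := h2.1; have c3 := h3.1; have c4 := h4.1
  unfold integrandJ
  positivity

/-- The integrand (10) at `(s, x)`: the `y₁ = s` dependence is `s^{p₁}(1−s)^{q₁}/((1−y₃) + y₃y₂·s)^{p₀+1}`,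
the rest is a function of `x = (y₂,…,y₅)` alone. -/
theorem integrandJ_vecCons (p : Fin 7 → ℤ) (q : Fin 5 → ℤ) (s : ℝ) (x : Fin 4 → ℝ) :
    integrandJ p q (Matrix.vecCons s x) =
      ((x 0) ^ (p 2) * (1 - x 0) ^ (q 1) * (x 1) ^ (p 3 + 1) * (1 - x 1) ^ (q 2) * (x 2) ^ (p 4) *
          (1 - x 2) ^ (q 3) * (x 3) ^ (p 5) * (1 - x 3) ^ (q 4) / (1 - x 1 * (1 - x 2 * x 3)) ^ (p 6 + 1)) *
        (s ^ (p 1) * (1 - s) ^ (q 0) / (1 - x 1 + x 1 * x 0 * s) ^ (p 0 + 1)) := by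
  simp only [integrandJ, Matrix.cons_val_zero, Matrix.cons_val_one, Matrix.cons_val]
  rw [show (1:ℝ) - x 1 * (1 - s * x 0) = 1 - x 1 + x 1 * x 0 * s by ring, div_mul_div_comm]
  congr 1 <;> ring


/-- `y^{(m:ℤ)+1} = y^{m+1}`. -/
theorem zpow_natCast_add_one (y : ℝ) (m : ℕ) : y ^ ((m : ℤ) + 1) = y ^ (m + 1) := by
  rw [← zpow_natCast]; norm_cast

/-- Membership in `(0,1)⁴` unpacked. -/
theorem mem_cube4 {x : Fin 4 → ℝ} (hx : x ∈ (univ.pi fun _ : Fin 4 => Ioo (0:ℝ) 1)) (i : Fin 4) :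
    0 < x i ∧ x i < 1 := by
  simpa using hx i (mem_univ i)

/-- The one-variable kernel `s ↦ K · s^a (1−s)^b / (α + βs)^c` is integrable on `(0,1)` for `α > 0`, `β ≥ 0`. -/
theorem integrableOn_kernel (K : ℝ) {α β : ℝ} (hα : 0 < α) (hβ : 0 ≤ β) (a b c : ℕ) :
    IntegrableOn (fun s : ℝ => K * (s ^ a * (1 - s) ^ b / (α + β * s) ^ c)) (Ioo 0 1) := by
  have hne : ∀ s ∈ Icc (0:ℝ) 1, (α + β * s) ^ c ≠ 0 := by
    intro s hs
    apply pow_ne_zero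
    have := mul_nonneg hβ hs.1
    linarith
  have hc : ContinuousOn (fun s : ℝ => K * (s ^ a * (1 - s) ^ b / (α + β * s) ^ c)) (Icc 0 1) :=
    ContinuousOn.mul continuousOn_const
      (ContinuousOn.div (Continuous.continuousOn (by fun_prop)) (Continuous.continuousOn (by fun_prop)) hne)
  exact (hc.integrableOn_Icc).mono_set Ioo_subset_Icc_self

/-- The kernel integral over `(0,1)` as an interval integral. -/
theorem setIntegral_Ioo_eq_intervalIntegral (f : ℝ → ℝ) :
    ∫ s in Ioo (0:ℝ) 1, f s = ∫ s in (0:ℝ)..1, f s := by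
  rw [intervalIntegral.integral_of_le zero_le_one, integral_Ioc_eq_integral_Ioo]

/-! ### `p₀₁` beyond the chamber -/

/-- **`J` under `p₀₁` — for ALL parameters with `p₀, p₁, q₁, p₁+q₁−p₀ ≥ 0`** (no chamber, no sign condition on
the other eight letters, no convergence hypothesis: both sides are the same junk value when divergent):
`J(p₀₁(p;q)) · p₁! q₁! = J(p;q) · p₀! (p₁+q₁−p₀)!`. [BrownZudilin2022, Sect. 7, the display for the symmetry
of `p₀+1`, `p₁+1`] — here from `EulerKernelSymmetry.euler_symmetry` in the variable `y₁` (with `α = 1−y₃`,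
`β = y₃y₂`) and Tonelli over `(y₂,…,y₅)`. -/
theorem Jintegral_p01_core (p : Fin 7 → ℤ) (q : Fin 5 → ℤ) {m₀ m₁ n₁ : ℕ} (hp0 : p 0 = m₀) (hp1 : p 1 = m₁)
    (hq0 : q 0 = n₁) (hle : m₀ ≤ m₁ + n₁) :
    Jintegral ![p 1, p 0, p 2, p 3, p 4, p 5, p 6] ![p 1 + q 0 - p 0, q 1, p 1 + q 2 - p 0, q 3, q 4] *
        ((m₁ ! * n₁ ! : ℕ) : ℝ) =
      Jintegral p q * ((m₀ ! * (m₁ + n₁ - m₀)! : ℕ) : ℝ) := by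
  set p' : Fin 7 → ℤ := ![p 1, p 0, p 2, p 3, p 4, p 5, p 6] with hp'
  set q' : Fin 5 → ℤ := ![p 1 + q 0 - p 0, q 1, p 1 + q 2 - p 0, q 3, q 4] with hq'
  rw [mul_comm (Jintegral p' q'), mul_comm (Jintegral p q)]
  unfold Jintegral
  refine setIntegral_openCube_eq_of_slices (measurable_integrandJ p' q') (measurable_integrandJ p q)
    (fun y hy => integrandJ_nonneg p' q' hy) (fun y hy => integrandJ_nonneg p q hy) (by positivity) (by positivity)
    (fun x hx => ?_)
  have hx0 := mem_cube4 hx 0; have hx1 := mem_cube4 hx 1; have hx2 := mem_cube4 hx 2; have hx3 := mem_cube4 hx 3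
  -- the two slices
  have hα : 0 < 1 - x 1 := by linarith [hx1.2]
  have hβ : 0 ≤ x 1 * x 0 := (mul_pos hx1.1 hx0.1).le
  set K : ℝ := (x 0) ^ (p 2) * (1 - x 0) ^ (q 1) * (x 1) ^ (p 3 + 1) * (1 - x 1) ^ (q 2) * (x 2) ^ (p 4) *
      (1 - x 2) ^ (q 3) * (x 3) ^ (p 5) * (1 - x 3) ^ (q 4) / (1 - x 1 * (1 - x 2 * x 3)) ^ (p 6 + 1) with hK
  have hk : p 1 + q 0 - p 0 = ((m₁ + n₁ - m₀ : ℕ) : ℤ) := by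
    rw [hp1, hq0, hp0]; push_cast [hle]; ring
  have hG : (fun s => integrandJ p q (Matrix.vecCons s x)) =
      fun s => K * (s ^ m₁ * (1 - s) ^ n₁ / (1 - x 1 + x 1 * x 0 * s) ^ (m₀ + 1)) := by
    funext s
    rw [integrandJ_vecCons, hp0, hp1, hq0, ← hK]
    simp only [zpow_natCast_add_one, zpow_natCast]
  have hF : (fun s => integrandJ p' q' (Matrix.vecCons s x)) =
      fun s => K * (1 - x 1) ^ ((m₁ : ℤ) - m₀) *
        (s ^ m₀ * (1 - s) ^ (m₁ + n₁ - m₀) / (1 - x 1 + x 1 * x 0 * s) ^ (m₁ + 1)) := by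
    funext s
    rw [integrandJ_vecCons]
    simp only [hp', hq', Matrix.cons_val_zero, Matrix.cons_val_one, Matrix.cons_val]
    have e : p 1 + q 2 - p 0 = q 2 + ((m₁ : ℤ) - m₀) := by rw [hp1, hp0]; ring
    rw [e, hk, hp0, hp1]
    simp only [zpow_natCast_add_one, zpow_natCast]
    rw [zpow_add₀ hα.ne', hK]
    ring
  refine ⟨?_, ?_, ?_⟩
  · rw [hF, show (fun s : ℝ => K * (1 - x 1) ^ ((m₁ : ℤ) - m₀) *
        (s ^ m₀ * (1 - s) ^ (m₁ + n₁ - m₀) / (1 - x 1 + x 1 * x 0 * s) ^ (m₁ + 1))) =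
        fun s => (K * (1 - x 1) ^ ((m₁ : ℤ) - m₀)) *
          (s ^ m₀ * (1 - s) ^ (m₁ + n₁ - m₀) / (1 - x 1 + x 1 * x 0 * s) ^ (m₁ + 1)) from rfl]
    exact integrableOn_kernel _ hα hβ _ _ _
  · rw [hG]
    exact integrableOn_kernel _ hα hβ _ _ _
  · rw [hF, hG, integral_const_mul, integral_const_mul, setIntegral_Ioo_eq_intervalIntegral,
      setIntegral_Ioo_eq_intervalIntegral]
    have hE := euler_symmetry m₀ m₁ n₁ hle hα hβ
    rw [zpow_sub₀ hα.ne', zpow_natCast, zpow_natCast]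
    generalize (∫ s in (0:ℝ)..1, s ^ m₁ * (1 - s) ^ n₁ / (1 - x 1 + x 1 * x 0 * s) ^ (m₀ + 1)) = I₁ at hE ⊢
    generalize (∫ s in (0:ℝ)..1, s ^ m₀ * (1 - s) ^ (m₁ + n₁ - m₀) / (1 - x 1 + x 1 * x 0 * s) ^ (m₁ + 1)) = I₂
      at hE ⊢
    have hαm : (1 - x 1) ^ m₀ ≠ 0 := pow_ne_zero _ hα.ne'
    calc ((m₁ ! * n₁ ! : ℕ) : ℝ) * (K * ((1 - x 1) ^ m₁ / (1 - x 1) ^ m₀) * I₂)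
        = K / (1 - x 1) ^ m₀ * ((m₁ ! : ℝ) * n₁ ! * (1 - x 1) ^ m₁ * I₂) := by
          push_cast; ring
      _ = K / (1 - x 1) ^ m₀ * ((m₀ ! : ℝ) * (m₁ + n₁ - m₀)! * (1 - x 1) ^ m₀ * I₁) := by rw [hE]
      _ = ((m₀ ! * (m₁ + n₁ - m₀)! : ℕ) : ℝ) * (K * I₁) := by
          push_cast; field_simp

/-- **`J` under `p₀₁` beyond the chamber** — `J(p₀₁(p;q)) · p₁! q₁! = J(p;q) · p₀! (p₁+q₁−p₀)!` for all
parameter vectors with `p₀, p₁, q₁, p₁+q₁−p₀ ≥ 0` (the same statement as `BarnesSymmetry.Jintegral_p01`, without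
its chamber hypothesis and without sign conditions on the other letters). [BrownZudilin2022, Sect. 7] -/
theorem Jintegral_p01 (p : Fin 7 → ℤ) (q : Fin 5 → ℤ) (h0 : 0 ≤ p 0) (h1 : 0 ≤ p 1) (hq : 0 ≤ q 0)
    (h10 : 0 ≤ p 1 + q 0 - p 0) :
    Jintegral ![p 1, p 0, p 2, p 3, p 4, p 5, p 6] ![p 1 + q 0 - p 0, q 1, p 1 + q 2 - p 0, q 3, q 4] *
        (((p 1).toNat ! * (q 0).toNat ! : ℕ) : ℝ) =
      Jintegral p q * ((((p 0).toNat ! * (p 1 + q 0 - p 0).toNat ! : ℕ)) : ℝ) := by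
  have hle : (p 0).toNat ≤ (p 1).toNat + (q 0).toNat := by omega
  have hk : (p 1 + q 0 - p 0).toNat = (p 1).toNat + (q 0).toNat - (p 0).toNat := by omega
  rw [hk]
  exact Jintegral_p01_core p q (Int.toNat_of_nonneg h0).symm (Int.toNat_of_nonneg h1).symm
    (Int.toNat_of_nonneg hq).symm hle

/-- **`I` under `p₀₁` on the whole common domain of convergence**: `I(p₀₁ a)·p₁!q₁! = I(a)·p₀!(p₁+q₁−p₀)!`
(letters of `a`) for `a` and `p₀₁ a` convergent — no chamber hypothesis (`p₀(a) = h₁₉(a)` may be the only letter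
whose sign convergence controls, as `p₁(p₀₁ a)`). [BrownZudilin2022, Sect. 7] -/
theorem cellularIntegral_genP01 {a : Fin 8 → ℤ} (ha : Converges a) (hga : Converges (genP01 a)) :
    cellularIntegral (genP01 a) * (((pOf a 1).toNat ! * (qOf a 0).toNat ! : ℕ) : ℝ) =
      cellularIntegral a * ((((pOf a 0).toNat ! * (pOf a 1 + qOf a 0 - pOf a 0).toNat ! : ℕ)) : ℝ) := by
  have h1 : 0 ≤ pOf a 1 := by
    have := ha (a 1 + a 2 + a 5 - a 3 - a 7) (by simp [convergenceForms])
    simp [pOf]; omega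
  have hq : 0 ≤ qOf a 0 := by
    have := ha (a 3) (by simp [convergenceForms])
    simpa [qOf] using this
  have h0 : 0 ≤ pOf a 0 := by
    have := hga (genP01 a 1 + genP01 a 2 + genP01 a 5 - genP01 a 3 - genP01 a 7) (by simp [convergenceForms])
    simp [pOf, genP01] at this ⊢; omega
  have h10 : 0 ≤ pOf a 1 + qOf a 0 - pOf a 0 := by
    have := hga (genP01 a 3) (by simp [convergenceForms])
    simp [pOf, qOf, genP01] at this ⊢; omega
  rw [cellularIntegral_eq_Jintegral, cellularIntegral_eq_Jintegral, pOf_genP01, qOf_genP01]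
  exact Jintegral_p01 (pOf a) (qOf a) h0 h1 hq h10

/-- **(27) under `p₀₁` — the `p₀₁`-conjunct of the named fact `invariance_of_converges'`, unconditionally**:
for `a` and `p₀₁ a` convergent, `I(p₀₁ a)/∏_{i∈F} h_i(p₀₁ a)! = I(a)/∏_{i∈F} h_i(a)!` (no chamber hypothesis).
[BrownZudilin2022, Sect. 7, eq. (27)] -/
theorem normalisedIntegral'_genP01 {a : Fin 8 → ℤ} (ha : Converges a) (hga : Converges (genP01 a)) :
    normalisedIntegral' (genP01 a) = normalisedIntegral' a := by
  have hI := cellularIntegral_genP01 ha hga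
  have hP := normF_genP01 a
  have hc : (((pOf a 1).toNat ! * (qOf a 0).toNat ! : ℕ) : ℝ) ≠ 0 := by positivity
  unfold normalisedIntegral'
  rw [div_eq_div_iff (normF_pos _).ne' (normF_pos _).ne']
  refine mul_right_cancel₀ hc ?_
  linear_combination ((Fset.map fun i => ((hForm a i).toNat ! : ℝ)).prod) * hI - cellularIntegral a * hP

end Summit.KontsevichZagierPeriods.Zeta5Search.JintegralEulerSymmetry

end
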